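import Literature.AlgebraicGeometry.Motives.GeneratingSectionsOfCocycleComap
import Literature.AlgebraicGeometry.Motives.ProjectiveOfGeneratingSections
import Literature.AlgebraicGeometry.Morphisms.ClosedImmersionNearFibreAffine
import Mathlib.AlgebraicGeometry.Morphisms.Proper
import Mathlib.AlgebraicGeometry.ProjectiveSpectrum.Proper
import HarnessLib

/-!
# A sub-family of a family of sections embeds ⇒ the family embeds (enlarging a linear system)

Topic `AlgebraicGeometry/Motives`; namespace `Literature.AlgebraicGeometry.Motives.GeneratingSections`.

Let `f : Y → Spec k` (`k` any commutative ring) and let `D : GeneratingSections ι' Y` be the datum of a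
family of sections `(t_j)_{j ∈ ι'}` generating a line bundle (★ `Motives/MorphismsToProjectiveSpace`: the
opens `U j = Y_{t_j}` and the ratios `t_l / t_j`), with its morphism `D.toProj f : Y → ℙ^{ι'}_k`
(Hartshorne II Thm. 7.1). This file proves the two halves of the elementary statement
«if a sub-linear-system already embeds `Y`, so does the whole system»:

* §1 **Converse of Hartshorne II Prop. 7.2**: if `D.toProj f` is a closed immersion then every
  `U j` is affine (`isAffineOpen_U_of_isClosedImmersion_toProj`) and every chart ring map
  `k[x_l/x_j : l] → Γ(Y, U j)` is onto (`surjective_sectionsRingHom_of_isClosedImmersion_toProj`).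
* §2 **Sub-families** `D.restrict e` along any map of index types `e : ι → ι'` whose sections still
  generate, and `isClosedImmersion_toProj_of_restrict`: for `f` universally closed, if the sub-family
  embeds then the family embeds (the charts `D₊(x_{e i})` cover the closed image; ★
  `isClosedImmersion_of_restrict`).
* §3 Sub-families of coefficient data `CocycleSections.restrict` (★ `Motives/GeneratingSectionsOfCocycle`)
  and their compatibility with `ofCocycleSections`.
* §4 **Linear recombination**: for ONE coefficient datum `S : CocycleSections (ι ⊕ ι') W` whose
  `inl`-sections `s_i` are `k`-linear combinations `s_i = ∑_j c_{ij} t_j` of its `inr`-sections `t_j`,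
  the glued ratio is `s_i/t_j = ∑_l c_{il} · t_l/t_j` (`ratio_inr_inl_eq_sum`), dropping the `s_i` keeps a
  closed immersion (`isClosedImmersion_toProj_restrict_inr_of_linear`, no properness needed), and the head
  `isClosedImmersion_toProj_of_linear`: **if the `s` embed `Y ↪ ℙ^ι_k` and each `s_i` is a
  `k`-combination of the `t_j`, then the `t` embed `Y ↪ ℙ^{ι'}_k`** (`f` universally closed).

This is the «enlargement of the linear system» step in EGA III 4.7.1 / Hartshorne III 12.11 ⇒ II 7.x
style arguments: the sections embedding a fibre are only `κ(𝔭)`-combinations of restricted global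
sections, and one wants the restricted global sections themselves to embed. Everything is proved;
two index-restriction definitions, no named fact, no instance. Cell `hodgecm-mathlib`, F-DAG (h2)
F-2a «fibre-only hypotheses» brick 1 (B-p20 (g11)); count-neutral (HC_CM is proved only modulo the 7
printed citations until rung 0 closes).

## References
* R. Hartshorne, *Algebraic Geometry*, GTM 52 (1977): II Thm. 7.1, II Prop. 7.2 (p. 151–152),
  II Example 7.8.1 / Prop. 7.3 context (linear projections). [Hartshorne1977]
* A. Grothendieck, J. Dieudonné, *EGA II* (Publ. Math. IHÉS 8, 1961), Prop. 4.2.3, 4.4.4 (closed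
  immersions into `ℙ(𝓔)` and surjectivity of `𝒮(𝓔) → ⊕ 𝓛^n`). [EGAII]
-/

universe v u

open CategoryTheory AlgebraicGeometry Limits HomogeneousLocalization TopologicalSpace Opposite
open MvPolynomial (X C eval₂Hom)
open Literature.AlgebraicGeometry.Motives.Segre

attribute [local instance] MvPolynomial.gradedAlgebra

-- `TopCat.Presheaf`/`Scheme.Opens` bookkeeping (as in ★ `Motives/GeneratingSectionsOfLineBundle`).
set_option backward.isDefEq.respectTransparency false

noncomputable section

namespace Literature.AlgebraicGeometry.Motives

namespace GeneratingSections

variable {ι ι' : Type} {Y : Scheme.{u}} {k : Type u} [CommRing k] (f : Y ⟶ Spec (.of k))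

/-! ## §1 Converse of Hartshorne II Prop. 7.2 -/

section Converse

variable (D : GeneratingSections ι Y)

/-- **If `Y → ℙ^ι_k` is a closed immersion, every `U i = Y_{s_i}` is affine**: it is the preimage of the
affine chart `D₊(x_i)` under an affine morphism (Hartshorne II Prop. 7.2, necessity of condition (1)).
[cite: Hartshorne1977, II Prop. 7.2] -/
theorem isAffineOpen_U_of_isClosedImmersion_toProj (H : IsClosedImmersion (D.toProj f)) (i : ι) :
    IsAffineOpen (D.U i) := by
  rw [← D.toProj_preimage_basicOpen f i]
  exact (Proj.isAffineOpen_basicOpen (grading ι k) (X i) (X_mem k i) zero_lt_one).preimage _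

/-- **If `Y → ℙ^ι_k` is a closed immersion, every chart ring map `k[x_j/x_i : j] → Γ(Y, U i)`,
`x_j/x_i ↦ s_j/s_i`, is surjective** (Hartshorne II Prop. 7.2, necessity of condition (2)): over `D₊(xᵢ)`
the morphism is `Spec Γ(Y, U i) → Spec (k[x]_{(xᵢ)})₀`, a closed immersion of affine schemes.
[cite: Hartshorne1977, II Prop. 7.2] -/
theorem surjective_sectionsRingHom_of_isClosedImmersion_toProj (H : IsClosedImmersion (D.toProj f))
    (i : ι) : Function.Surjective (D.sectionsRingHom f i) := by
  have hU : IsAffineOpen (D.U i) := D.isAffineOpen_U_of_isClosedImmersion_toProj f H i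
  have hres : IsClosedImmersion (D.toProj f ∣_ Proj.basicOpen (grading ι k) (X i)) :=
    IsZariskiLocalAtTarget.restrict H _
  have hfac : D.toProj f ∣_ Proj.basicOpen (grading ι k) (X i) =
      (Y.isoOfEq (D.toProj_preimage_basicOpen f i)).hom ≫
        (hU.isoSpec.hom ≫ Spec.map (CommRingCat.ofHom (D.sectionsRingHom f i))) ≫
        (Proj.basicOpenIsoSpec (grading ι k) (X i) (X_mem k i) zero_lt_one).inv := by
    rw [← cancel_mono (Proj.basicOpen (grading ι k) (X i)).ι]
    simp only [Category.assoc, morphismRestrict_ι, Proj.basicOpenIsoSpec_inv_ι,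
      IsAffineOpen.isoSpec_hom]
    rw [← Scheme.isoOfEq_hom_ι Y (D.toProj_preimage_basicOpen f i), Category.assoc, ι_toProj,
      chart_eq]
  rw [hfac, MorphismProperty.cancel_left_of_respectsIso @IsClosedImmersion,
    MorphismProperty.cancel_right_of_respectsIso @IsClosedImmersion,
    MorphismProperty.cancel_left_of_respectsIso @IsClosedImmersion] at hres
  have h := Literature.AlgebraicGeometry.Morphisms.surjective_of_isClosedImmersion_SpecMap
    (CommRingCat.ofHom (D.sectionsRingHom f i))
  simpa using h

/-- With `Y → ℙ^ι_k` a closed immersion, `Γ(Y, U i)` is generated as a ring by the constants and the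
ratios `s_j/s_i` (§1 with ★ `range_sectionsRingHom`). [cite: Hartshorne1977, II Prop. 7.2] -/
theorem closure_cstr_ratio_eq_top_of_isClosedImmersion_toProj (H : IsClosedImmersion (D.toProj f))
    (i : ι) : Subring.closure (Set.range (D.cstr f i) ∪ Set.range (D.ratio i)) = ⊤ := by
  rw [← D.range_sectionsRingHom f i, RingHom.range_eq_top]
  exact D.surjective_sectionsRingHom_of_isClosedImmersion_toProj f H i

end Converse

/-! ## §2 Sub-families of generating sections -/

section Restrict

variable (D : GeneratingSections ι' Y) (e : ι → ι') (hcov : ⨆ i, D.U (e i) = ⊤)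

/-- **The sub-family `(s_{e i})_{i ∈ ι}`** of a family of generating sections, along any map of index types
`e : ι → ι'`, provided its non-vanishing loci still cover: opens `U (e i)`, ratios `s_{e j}/s_{e i}`
(for `e` a bijection this is ★ `reindex`). [cite: Hartshorne1977, II Thm. 7.1] -/
def restrict : GeneratingSections ι Y where
  U i := D.U (e i)
  iSup_U := hcov
  ratio i j := D.ratio (e i) (e j)
  ratio_self i := D.ratio_self (e i)
  basicOpen_ratio i j := D.basicOpen_ratio (e i) (e j)
  ratio_mul_ratio i j l := D.ratio_mul_ratio (e i) (e j) (e l)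

/-- The opens of the sub-family (`rfl`). [cite: Hartshorne1977, II Thm. 7.1] -/
@[simp] theorem restrict_U (i : ι) : (D.restrict e hcov).U i = D.U (e i) := rfl

/-- The ratios of the sub-family (`rfl`). [cite: Hartshorne1977, II Thm. 7.1] -/
@[simp] theorem restrict_ratio (i j : ι) : (D.restrict e hcov).ratio i j = D.ratio (e i) (e j) := rfl

/-- The constants of the sub-family's charts are the constants (`rfl`). [folklore] -/
private theorem restrict_cstr (i : ι) : (D.restrict e hcov).cstr f i = D.cstr f (e i) := rfl

/-- The ring generated by the constants and the ratios of the sub-family at the chart `i` is contained in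
the one generated by the constants and ALL the ratios at the chart `e i`. [folklore] -/
private theorem closure_restrict_le (i : ι) :
    Subring.closure (Set.range ((D.restrict e hcov).cstr f i) ∪ Set.range ((D.restrict e hcov).ratio i)) ≤
      Subring.closure (Set.range (D.cstr f (e i)) ∪ Set.range (D.ratio (e i))) := by
  apply Subring.closure_mono
  rintro _ (⟨c, rfl⟩ | ⟨j, rfl⟩)
  · exact Or.inl ⟨c, rfl⟩
  · exact Or.inr ⟨e j, rfl⟩

/-- **A sub-family embeds ⇒ the family embeds** (enlarging a linear system keeps a closed immersion): for
`f : Y → Spec k` universally closed, if the morphism `Y → ℙ^ι_k` of the sub-family `(s_{e i})_i` is a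
closed immersion, so is the morphism `Y → ℙ^{ι'}_k` of the whole family. Proof: the charts `D₊(x_{e i})`
have the affine preimages `Y_{s_{e i}}` with onto chart maps (§1 for the sub-family, whose ratios are
among the family's), they cover the image, and the image is closed (`Y → ℙ^{ι'}_k` is universally
closed as `ℙ^{ι'}_k → Spec k` is separated); conclude by ★ `isClosedImmersion_of_restrict`
(Hartshorne II Prop. 7.2 chart criterion). [cite: Hartshorne1977, II Prop. 7.2] -/
theorem isClosedImmersion_toProj_of_restrict [UniversallyClosed f]
    (H : IsClosedImmersion ((D.restrict e hcov).toProj f)) : IsClosedImmersion (D.toProj f) := by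
  refine isClosedImmersion_of_restrict (D.toProj f) (κ := ι)
    (fun i ↦ Proj.basicOpen (grading ι' k) (X (e i))) ?_ (fun i ↦ ?_) ?_
  · simp_rw [toProj_preimage_basicOpen]
    exact hcov
  · refine D.isClosedImmersion_toProj_restrict f (e i)
      ((D.restrict e hcov).isAffineOpen_U_of_isClosedImmersion_toProj f H i)
      (D.sectionsRingHom_surjective_of_closure_eq_top f (e i) (top_le_iff.mp ?_))
    exact ((D.restrict e hcov).closure_cstr_ratio_eq_top_of_isClosedImmersion_toProj f H i).symm.trans_le
      (D.closure_restrict_le f e hcov i)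
  · have h1 : UniversallyClosed (D.toProj f ≫ toSpec ι' k) := by
      rw [toProj_toSpec]
      infer_instance
    have h2 : IsSeparated (toSpec ι' k) := by
      unfold toSpec
      infer_instance
    have h3 : UniversallyClosed (D.toProj f) := .of_comp_of_isSeparated _ (toSpec ι' k)
    exact (D.toProj f).isClosedMap.isClosed_range

end Restrict

/-! ## §3 Sub-families of coefficient data -/

namespace CocycleSections

variable {α : Type v} {W : α → Y.Opens}

/-- Two coefficient data with the same coefficients are equal (the datum of Hartshorne II, proof of
Thm. 7.1, is the family of coefficients). [cite: Hartshorne1977, II proof of Thm. 7.1] -/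
@[ext] theorem ext {S T : CocycleSections ι W} (h : S.coeff = T.coeff) : S = T := by
  obtain ⟨c, _, _⟩ := S
  obtain ⟨c', _, _⟩ := T
  obtain rfl : c = c' := h
  rfl

variable (S : CocycleSections ι' W) (e : ι → ι')

/-- **The sub-family of coefficient data** along a map of index types `e : ι → ι'`: the coefficients
`c (e i) a` of the sections `t_{e i}` (same trivialising opens). [cite: Hartshorne1977, II proof of Thm. 7.1] -/
def restrict : CocycleSections ι W where
  coeff i a := S.coeff (e i) a
  cross i j a b := S.cross (e i) (e j) a b
  locus i a b := S.locus (e i) a b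

/-- The coefficients of the sub-family (`rfl`). [cite: Hartshorne1977, II proof of Thm. 7.1] -/
@[simp] theorem restrict_coeff (i : ι) (a : α) : (S.restrict e).coeff i a = S.coeff (e i) a := rfl

/-- If the sub-family generates, so does the family. [cite: Hartshorne1977, II Thm. 7.1] -/
theorem iSup_basicOpen_coeff_eq_top_of_restrict
    (hcov : ⨆ i, ⨆ a, Y.basicOpen ((S.restrict e).coeff i a) = ⊤) :
    ⨆ j, ⨆ a, Y.basicOpen (S.coeff j a) = ⊤ :=
  top_le_iff.mp (hcov.ge.trans (iSup_le fun i ↦ le_iSup (fun j ↦ ⨆ a, Y.basicOpen (S.coeff j a)) (e i)))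

/-- **`ofCocycleSections` of a sub-family is the sub-family of `ofCocycleSections`**: same opens
`U i = ⋃_a Y_{c (e i) a}` by definition, same ratios by the uniqueness of the glued ratio
(★ `ofCocycleSections_ratio_unique`). [cite: Hartshorne1977, II proof of Thm. 7.1] -/
theorem ofCocycleSections_restrict (hcov : ⨆ i, ⨆ a, Y.basicOpen ((S.restrict e).coeff i a) = ⊤)
    (hcov' : ⨆ j, ⨆ a, Y.basicOpen (S.coeff j a) = ⊤) :
    ofCocycleSections W (S.restrict e) hcov = (ofCocycleSections W S hcov').restrict e hcov := by
  refine eq_of_U_eq (fun i ↦ rfl) fun i j ↦ ?_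
  rw [eqToHom_refl, op_id]
  erw [CategoryTheory.Functor.map_id]
  exact (ofCocycleSections_ratio_unique W (S.restrict e) hcov i j _ fun a ↦
    ofCocycleSections_ratio_res_mul W S hcov' (e i) (e j) a).symm

end CocycleSections

/-! ## §4 Linear recombination: dropping sections that are combinations of the others -/

section Linear

variable {α : Type v} {W : α → Y.Opens} [Fintype ι'] (S : CocycleSections (ι ⊕ ι') W)
  (c : ι → ι' → k)
  (hlin : ∀ i a, S.coeff (.inl i) a =
    ∑ j, Y.presheaf.map (homOfLE (le_top : W a ≤ ⊤)).op (pull f (c i j)) * S.coeff (.inr j) a)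

omit [Fintype ι'] in
/-- Two parallel restriction maps of `𝒪_Y` agree (the category of opens is thin). [folklore] -/
private theorem map_irrel {A B : Y.Opens} (p q : op A ⟶ op B) (x : Γ(Y, A)) :
    Y.presheaf.map p x = Y.presheaf.map q x := by
  have : p = q := congrArg Quiver.Hom.op (Subsingleton.elim p.unop q.unop)
  rw [this]

omit [Fintype ι'] in
/-- Two-step restriction of `𝒪_Y` equals the one-step restriction with the same ends. [folklore] -/
private theorem map_map_eq {A B B' : Y.Opens} (p : op A ⟶ op B) (q : op B ⟶ op B') (r : op A ⟶ op B')
    (x : Γ(Y, A)) : Y.presheaf.map q (Y.presheaf.map p x) = Y.presheaf.map r x := by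
  rw [← CommRingCat.comp_apply, ← Functor.map_comp]
  exact map_irrel _ _ _

include hlin in
/-- `Y_{s_i, a} ⊆ ⋃_j Y_{t_j, a}`: a point where `s_i = ∑ c_{ij} t_j` does not vanish is a point where some
`t_j` does not vanish (generation, Hartshorne II Thm. 7.1). [cite: Hartshorne1977, II Thm. 7.1] -/
theorem basicOpen_inl_le_of_linear (i : ι) (a : α) :
    Y.basicOpen (S.coeff (.inl i) a) ≤ ⨆ j, Y.basicOpen (S.coeff (.inr j) a) := by
  rw [hlin i a]
  classical
  refine (Finset.sum_induction _ (fun s ↦ Y.basicOpen s ≤ ⨆ j, Y.basicOpen (S.coeff (.inr j) a))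
    (fun x y hx hy ↦ (Y.basicOpen_add_le x y).trans (sup_le hx hy)) ?_ fun j _ ↦ ?_)
  · rw [Scheme.basicOpen_zero]
    exact bot_le
  · rw [Scheme.basicOpen_mul]
    exact inf_le_right.trans (le_iSup (fun j ↦ Y.basicOpen (S.coeff (.inr j) a)) j)

include hlin in
/-- **If the `s` generate and each `s_i` is a combination of the `t_j`, the `t` generate.**
[cite: Hartshorne1977, II Thm. 7.1] -/
theorem iSup_basicOpen_inr_eq_top_of_linear
    (hcov : ⨆ i, ⨆ a, Y.basicOpen ((S.restrict Sum.inl).coeff i a) = ⊤) :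
    ⨆ j, ⨆ a, Y.basicOpen ((S.restrict Sum.inr).coeff j a) = ⊤ := by
  simp only [CocycleSections.restrict_coeff] at hcov ⊢
  refine top_le_iff.mp (hcov.ge.trans (iSup_le fun i ↦ iSup_le fun a ↦
    (basicOpen_inl_le_of_linear f S c hlin i a).trans (iSup_le fun j ↦ ?_)))
  exact (le_iSup (fun a ↦ Y.basicOpen (S.coeff (.inr j) a)) a).trans
    (le_iSup (fun j ↦ ⨆ a, Y.basicOpen (S.coeff (.inr j) a)) j)

variable (hcov : ⨆ x, ⨆ a, Y.basicOpen (S.coeff x a) = ⊤)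

include hlin in
/-- **The glued ratio of a linear combination**: `s_i / t_j = ∑_l c_{il} · (t_l / t_j)` on `Y_{t_j}`, by the
uniqueness of the ratio (★ `ofCocycleSections_ratio_unique`: both sides times `t_j` give `s_i` on every
`Y_{t_j, a}`). [cite: Hartshorne1977, II proof of Thm. 7.1] -/
theorem ratio_inr_inl_eq_sum (j : ι') (i : ι) :
    (ofCocycleSections W S hcov).ratio (.inr j) (.inl i) =
      ∑ l, (ofCocycleSections W S hcov).cstr f (.inr j) (c i l) *
        (ofCocycleSections W S hcov).ratio (.inr j) (.inr l) := by
  symm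
  refine ofCocycleSections_ratio_unique W S hcov (.inr j) (.inl i) _ fun a ↦ ?_
  rw [map_sum, Finset.sum_mul]
  have hrhs : Y.presheaf.map (homOfLE (Y.basicOpen_le (S.coeff (.inr j) a))).op (S.coeff (.inl i) a) =
      ∑ l, Y.presheaf.map (homOfLE ((Y.basicOpen_le (S.coeff (.inr j) a)).trans
          (le_top : W a ≤ ⊤))).op (pull f (c i l)) *
        Y.presheaf.map (homOfLE (Y.basicOpen_le (S.coeff (.inr j) a))).op (S.coeff (.inr l) a) := by
    rw [hlin i a, map_sum]
    refine Finset.sum_congr rfl fun l _ ↦ ?_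
    rw [map_mul, map_map_eq]
  rw [hrhs]
  refine Finset.sum_congr rfl fun l _ ↦ ?_
  rw [map_mul, mul_assoc, ofCocycleSections_ratio_res_mul W S hcov (.inr j) (.inr l) a]
  congr 1
  -- the constant `c_{il}` restricted along either route is the same section over `Y_{t_j, a}`
  change Y.presheaf.map _ ((Y.presheaf.map (homOfLE le_top).op).hom.comp (pull f) (c i l)) = _
  rw [RingHom.comp_apply]
  exact map_map_eq _ _ _ _

include hlin in
/-- **Dropping sections that are linear combinations of the others keeps a closed immersion**: if the
morphism `Y → ℙ^{ι ⊕ ι'}_k` of all the sections `(s, t)` is a closed immersion and each `s_i` is a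
`k`-combination of the `t_j`, then the morphism `Y → ℙ^{ι'}_k` of the `t` alone is a closed immersion —
Hartshorne II Prop. 7.2 on the charts `Y_{t_j}`: affine by §1, and `Γ(Y, Y_{t_j})` is generated by the
constants and the `s_i/t_j`, `t_l/t_j` (§1), where `s_i/t_j = ∑ c_{il} t_l/t_j`. No properness needed.
[cite: Hartshorne1977, II Prop. 7.2] -/
theorem isClosedImmersion_toProj_restrict_inr_of_linear
    (hcov_inr : ⨆ j, ⨆ a, Y.basicOpen ((S.restrict Sum.inr).coeff j a) = ⊤)
    (H : IsClosedImmersion ((ofCocycleSections W S hcov).toProj f)) :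
    IsClosedImmersion ((ofCocycleSections W (S.restrict Sum.inr) hcov_inr).toProj f) := by
  rw [CocycleSections.ofCocycleSections_restrict S Sum.inr hcov_inr hcov]
  refine ((ofCocycleSections W S hcov).restrict Sum.inr hcov_inr).isClosedImmersion_toProj f
    (fun j ↦ (ofCocycleSections W S hcov).isAffineOpen_U_of_isClosedImmersion_toProj f H (.inr j))
    fun j ↦ ?_
  refine ((ofCocycleSections W S hcov).restrict Sum.inr hcov_inr).sectionsRingHom_surjective_of_closure_eq_top
    f j (top_le_iff.mp ?_)
  refine ((ofCocycleSections W S hcov).closure_cstr_ratio_eq_top_of_isClosedImmersion_toProj f H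
    (.inr j)).symm.trans_le ?_
  rw [Subring.closure_le]
  rintro _ (⟨c', rfl⟩ | ⟨x, rfl⟩)
  · exact Subring.subset_closure (Or.inl ⟨c', rfl⟩)
  · obtain (i | l) := x
    · -- `s_i / t_j = ∑ c_{il} · t_l / t_j` lies in the ring generated by the constants and the `t_l/t_j`
      rw [ratio_inr_inl_eq_sum f S c hlin hcov j i]
      refine Subring.sum_mem _ fun l _ ↦ Subring.mul_mem _ ?_ ?_
      · exact Subring.subset_closure (Or.inl ⟨c i l, rfl⟩)
      · exact Subring.subset_closure (Or.inr ⟨l, rfl⟩)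
    · exact Subring.subset_closure (Or.inr ⟨l, rfl⟩)

include hlin in
/-- **Enlarging the linear system by sections that span: if the sections `s` embed `Y ↪ ℙ^ι_k` and every
`s_i` is a `k`-linear combination of the sections `t_j` (of the same line bundle, `f : Y → Spec k`
universally closed), then the `t` embed `Y ↪ ℙ^{ι'}_k`.** First the whole family `(s, t)` embeds (§2:
a sub-family embeds), then the `s` may be dropped (§4). This is the form in which «the global sections
restricted to a fibre span the fibre's embedding sections» is used (EGA III 4.7.1 via II 4.4.4;
Hartshorne II Prop. 7.2). [cite: Hartshorne1977, II Prop. 7.2] -/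
theorem isClosedImmersion_toProj_of_linear [UniversallyClosed f]
    (hcov_inl : ⨆ i, ⨆ a, Y.basicOpen ((S.restrict Sum.inl).coeff i a) = ⊤)
    (hcov_inr : ⨆ j, ⨆ a, Y.basicOpen ((S.restrict Sum.inr).coeff j a) = ⊤)
    (H : IsClosedImmersion ((ofCocycleSections W (S.restrict Sum.inl) hcov_inl).toProj f)) :
    IsClosedImmersion ((ofCocycleSections W (S.restrict Sum.inr) hcov_inr).toProj f) := by
  have hcov : ⨆ x, ⨆ a, Y.basicOpen (S.coeff x a) = ⊤ :=
    S.iSup_basicOpen_coeff_eq_top_of_restrict Sum.inl hcov_inl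
  refine isClosedImmersion_toProj_restrict_inr_of_linear f S c hlin hcov hcov_inr ?_
  rw [CocycleSections.ofCocycleSections_restrict S Sum.inl hcov_inl hcov] at H
  exact (ofCocycleSections W S hcov).isClosedImmersion_toProj_of_restrict f Sum.inl hcov_inl H

end Linear

end GeneratingSections

end Literature.AlgebraicGeometry.Motives
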